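import Literature.NumberTheory.Transcendental.ExpPointsCuspTrichotomy
import Literature.NumberTheory.Transcendental.ExpPointsLogFreeUniformizeAlg
import HarnessLib

/-!
# The cusp trichotomy with the algebraic uniformisation of the cusp remembered

Same setting, same statement and same proof as `ExpPointsCuspTrichotomy.cusp_trichotomy`
(`W ⊆ ℂ² × ℂ²` defined over `ℚ`, `zariskiDim ℂ W < 2`, an analytic branch at infinity
`𝔟(t) = ((t⁻ᵉ, Φ₁ t / tᴺ), (Φ₂ t / tᴺ, Φ₃ t / tᴺ)) ⊆ W` carrying independent exponential points with
`t → 0`), except that in the first case — the normalised log-free cusp ray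
`σ ↦ ((2πi σ⁻ᵉ + ℓu σ, 2πi (A(σ⁻¹) + g σ) + ℓv σ), (e^{ℓu σ}, e^{ℓv σ}))` with transcendental tail —
the conclusion also records the ALGEBRAIC UNIFORMISATION of the cusp which the proof constructs:
a substitution `t = T σ` (`T` analytic at `0`, `T 0 = 0`), germs `ℓ₀, ℓ₁, Φ₁` analytic at `0`, an
exponent `N₀` and a radius `r > 0` such that the `t`-branch `((t⁻ᵉ, Φ₁ t / t^{N₀}), (e^{ℓ₀ t}, e^{ℓ₁ t}))`
lies in `W` for `0 < |t| < r` and the cusp point at `σ` is the `t`-branch point at `t = T σ`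
(`(T σ)⁻ᵉ = 2πi σ⁻ᵉ + ℓu σ`, `Φ₁ (T σ) / (T σ)^{N₀} = 2πi (A(σ⁻¹) + g σ) + ℓv σ`, `ℓ₀ (T σ) = ℓu σ`,
`ℓ₁ (T σ) = ℓv σ`). Ingredients: `ExpPointsLogFreeUniformizeAlg` (the cusp form with its
substitution) and the sign normalisation `exists_normalised_cusp_alg` below (for `ε = -1` the
`t`-branch is complex-conjugated too; it stays in `W` since `W` is defined over `ℚ`).
PROVED, no definition. [folklore]
-/

noncomputable section

open Complex Filter Topology Set Metric Polynomial
open scoped Real ComplexConjugate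

namespace Literature.NumberTheory.Transcendental

open Literature.Analysis.Complex.MeromorphicGerm (frequently_nhdsNE_of_forall_exists)
open Literature.Analysis.Complex.BranchOrders (exists_zpow_exp_form)

/-- The branch point `((t⁻ᵉ, Φ₁ t / tᴺ), (Φ₂ t / tᴺ, Φ₃ t / tᴺ)) ∈ ℂ² × ℂ²` (local notation). -/
local notation3 "𝔟[" e ", " N ", " Φ₁ ", " Φ₂ ", " Φ₃ ", " t "]" =>
  (Sum.elim ![((t : ℂ) ^ (e : ℕ))⁻¹, (Φ₁ : ℂ → ℂ) t / t ^ (N : ℕ)]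
    ![(Φ₂ : ℂ → ℂ) t / t ^ (N : ℕ), (Φ₃ : ℂ → ℂ) t / t ^ (N : ℕ)] : Fin 2 ⊕ Fin 2 → ℂ)

/-- The branch point in exponential form `((t⁻ᵉ, Φ₁ t / tᴺ), (e^{ℓ₀ t}, e^{ℓ₁ t}))` (local notation). -/
local notation3 "𝔟ₑ[" e ", " N ", " Φ₁ ", " ℓ₀ ", " ℓ₁ ", " t "]" =>
  (Sum.elim ![((t : ℂ) ^ (e : ℕ))⁻¹, (Φ₁ : ℂ → ℂ) t / t ^ (N : ℕ)]
    ![Complex.exp ((ℓ₀ : ℂ → ℂ) t), Complex.exp ((ℓ₁ : ℂ → ℂ) t)] : Fin 2 ⊕ Fin 2 → ℂ)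

/-- The normalised cusp form `((2πi s⁻ᵉ + ℓu s, 2πi (A(s⁻¹) + g s) + ℓv s), (e^{ℓu s}, e^{ℓv s}))`
(local notation). -/
local notation3 "𝔠₁[" e ", " A ", " g ", " ℓu ", " ℓv ", " s "]" =>
  (Sum.elim ![2 * (Real.pi : ℂ) * I * (s : ℂ)⁻¹ ^ (e : ℕ) + (ℓu : ℂ → ℂ) s,
      2 * (Real.pi : ℂ) * I * (Polynomial.eval s⁻¹ (A : ℂ[X]) + (g : ℂ → ℂ) s) + (ℓv : ℂ → ℂ) s]
    ![Complex.exp ((ℓu : ℂ → ℂ) s), Complex.exp ((ℓv : ℂ → ℂ) s)] : Fin 2 ⊕ Fin 2 → ℂ)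

/-- The cusp form with a sign `ε` (local notation). -/
local notation3 "𝔠[" ε ", " e ", " A ", " g ", " ℓu ", " ℓv ", " s "]" =>
  (Sum.elim ![2 * (Real.pi : ℂ) * I * (ε : ℂ) * (s : ℂ)⁻¹ ^ (e : ℕ) + (ℓu : ℂ → ℂ) s,
      2 * (Real.pi : ℂ) * I * (Polynomial.eval s⁻¹ (A : ℂ[X]) + (g : ℂ → ℂ) s) + (ℓv : ℂ → ℂ) s]
    ![Complex.exp ((ℓu : ℂ → ℂ) s), Complex.exp ((ℓv : ℂ → ℂ) s)] : Fin 2 ⊕ Fin 2 → ℂ)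

/-! ### Normalisation of the sign, carrying the uniformisation -/

/-- **The normalised cusp ray, with its uniformisation.** `exists_normalised_cusp` together with
the substitution data of `exists_cusp_form_of_logFree_alg`: from the cusp form with sign `ε = ±1`
and a substitution `t = T s` identifying it with the `t`-branch
`((t⁻ᵉ, Φ₁ t / tᴺ), (e^{ℓ₀ t}, e^{ℓ₁ t})) ⊆ W`, one obtains the same with `ε = 1` (for `ε = -1`
the cusp, the `t`-branch and the substitution are complex-conjugated; `W` is defined over `ℚ`).
[folklore] -/
theorem exists_normalised_cusp_alg {W : Set (Fin 2 ⊕ Fin 2 → ℂ)}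
    (hW : IsDefinedOver (⊥ : Subfield ℂ) W) {e N : ℕ} {ε : ℂ} {A : ℂ[X]} {g ℓu ℓv : ℂ → ℂ}
    {ρ₀ : ℝ} {Φ₁ ℓ₀ ℓ₁ T : ℂ → ℂ} {r : ℝ} (hε : ε = 1 ∨ ε = -1)
    (hg : AnalyticAt ℂ g 0) (hg0 : g 0 = 0) (hℓu : AnalyticAt ℂ ℓu 0) (hℓv : AnalyticAt ℂ ℓv 0)
    (hin : ∀ s : ℂ, 0 < ‖s‖ → ‖s‖ < ρ₀ → 𝔠[ε, e, A, g, ℓu, ℓv, s] ∈ W)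
    (hhit : ∀ δ : ℝ, 0 < δ → Set.Infinite {x | x ∈ indepExpPoints W ∧ ∃ ρ : ℝ, 0 < ρ ∧ ρ < δ ∧
      Sum.elim x (Complex.exp ∘ x) = 𝔠[ε, e, A, g, ℓu, ℓv, (ρ : ℂ)]})
    (hT : AnalyticAt ℂ T 0) (hT0 : T 0 = 0) (hℓ₀ : AnalyticAt ℂ ℓ₀ 0) (hℓ₁ : AnalyticAt ℂ ℓ₁ 0)
    (hΦ₁ : AnalyticAt ℂ Φ₁ 0)
    (hbr : ∀ t : ℂ, 0 < ‖t‖ → ‖t‖ < r → 𝔟ₑ[e, N, Φ₁, ℓ₀, ℓ₁, t] ∈ W)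
    (hlink : ∀ s : ℂ, 0 < ‖s‖ → ‖s‖ < ρ₀ → 0 < ‖T s‖ ∧ ‖T s‖ < r ∧
      ((T s) ^ e)⁻¹ = 2 * (Real.pi : ℂ) * I * ε * s⁻¹ ^ e + ℓu s ∧
      Φ₁ (T s) / (T s) ^ N = 2 * (Real.pi : ℂ) * I * (Polynomial.eval s⁻¹ A + g s) + ℓv s ∧
      ℓ₀ (T s) = ℓu s ∧ ℓ₁ (T s) = ℓv s) :
    ∃ (A' : ℂ[X]) (g' ℓu' ℓv' Φ₁' ℓ₀' ℓ₁' T' : ℂ → ℂ), AnalyticAt ℂ g' 0 ∧ g' 0 = 0 ∧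
      AnalyticAt ℂ ℓu' 0 ∧ AnalyticAt ℂ ℓv' 0 ∧
      (∀ s : ℂ, 0 < ‖s‖ → ‖s‖ < ρ₀ → 𝔠₁[e, A', g', ℓu', ℓv', s] ∈ W) ∧
      (∀ δ : ℝ, 0 < δ → Set.Infinite {x | x ∈ indepExpPoints W ∧ ∃ ρ : ℝ, 0 < ρ ∧ ρ < δ ∧
        Sum.elim x (Complex.exp ∘ x) = 𝔠₁[e, A', g', ℓu', ℓv', (ρ : ℂ)]}) ∧
      AnalyticAt ℂ T' 0 ∧ T' 0 = 0 ∧ AnalyticAt ℂ ℓ₀' 0 ∧ AnalyticAt ℂ ℓ₁' 0 ∧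
      AnalyticAt ℂ Φ₁' 0 ∧
      (∀ t : ℂ, 0 < ‖t‖ → ‖t‖ < r → 𝔟ₑ[e, N, Φ₁', ℓ₀', ℓ₁', t] ∈ W) ∧
      (∀ s : ℂ, 0 < ‖s‖ → ‖s‖ < ρ₀ → 0 < ‖T' s‖ ∧ ‖T' s‖ < r ∧
        ((T' s) ^ e)⁻¹ = 2 * (Real.pi : ℂ) * I * s⁻¹ ^ e + ℓu' s ∧
        Φ₁' (T' s) / (T' s) ^ N = 2 * (Real.pi : ℂ) * I * (Polynomial.eval s⁻¹ A' + g' s) + ℓv' s ∧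
        ℓ₀' (T' s) = ℓu' s ∧ ℓ₁' (T' s) = ℓv' s) := by
  rcases hε with rfl | rfl
  · -- `ε = 1`: nothing to do
    refine ⟨A, g, ℓu, ℓv, Φ₁, ℓ₀, ℓ₁, T, hg, hg0, hℓu, hℓv, fun s hs0 hsρ => ?_, fun δ hδ => ?_,
      hT, hT0, hℓ₀, hℓ₁, hΦ₁, hbr, fun s hs0 hsρ => ?_⟩
    · have := hin s hs0 hsρ
      simpa only [mul_one] using this
    · refine (hhit δ hδ).mono ?_
      rintro x ⟨hxH, ρ, hρ, hρδ, hpt⟩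
      refine ⟨hxH, ρ, hρ, hρδ, ?_⟩
      rw [hpt]; simp only [mul_one]
    · have := hlink s hs0 hsρ
      simpa only [mul_one] using this
  · -- `ε = -1`: conjugate branch
    set A' : ℂ[X] := -A.map (starRingEnd ℂ) with hA'
    set g' : ℂ → ℂ := fun s => -conj (g (conj s)) with hg'
    set ℓu' : ℂ → ℂ := fun s => conj (ℓu (conj s)) with hℓu'
    set ℓv' : ℂ → ℂ := fun s => conj (ℓv (conj s)) with hℓv'
    set Φ₁' : ℂ → ℂ := fun t => conj (Φ₁ (conj t)) with hΦ₁'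
    set ℓ₀' : ℂ → ℂ := fun t => conj (ℓ₀ (conj t)) with hℓ₀'
    set ℓ₁' : ℂ → ℂ := fun t => conj (ℓ₁ (conj t)) with hℓ₁'
    set T' : ℂ → ℂ := fun s => conj (T (conj s)) with hT'
    have hconj : ∀ s : ℂ, (fun k => conj (𝔠[(-1 : ℂ), e, A, g, ℓu, ℓv, conj s] k)) =
        𝔠₁[e, A', g', ℓu', ℓv', s] := by
      intro s
      funext k
      rcases k with k | k <;> fin_cases k
      · simp only [Sum.elim_inl, Fin.zero_eta, Fin.isValue, Matrix.cons_val_zero, map_add, map_mul,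
          map_neg, map_one, map_pow, map_inv₀, Complex.conj_conj, map_ofNat, Complex.conj_ofReal,
          Complex.conj_I, hℓu']
        ring
      · simp only [Sum.elim_inl, Fin.mk_one, Fin.isValue, Matrix.cons_val_one, Matrix.cons_val_zero,
          map_add, map_mul, conj_eval, map_inv₀, Complex.conj_conj, map_ofNat, Complex.conj_ofReal,
          Complex.conj_I, hA', hg', hℓv', Polynomial.eval_neg]
        ring
      · simp only [Sum.elim_inr, Fin.zero_eta, Fin.isValue, Matrix.cons_val_zero,
          ← Complex.exp_conj, hℓu']
      · simp only [Sum.elim_inr, Fin.mk_one, Fin.isValue, Matrix.cons_val_one, Matrix.cons_val_zero,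
          ← Complex.exp_conj, hℓv']
    have hconjb : ∀ t : ℂ, (fun k => conj (𝔟ₑ[e, N, Φ₁, ℓ₀, ℓ₁, conj t] k)) =
        𝔟ₑ[e, N, Φ₁', ℓ₀', ℓ₁', t] := by
      intro t
      funext k
      rcases k with k | k <;> fin_cases k
      · simp only [Sum.elim_inl, Fin.zero_eta, Fin.isValue, Matrix.cons_val_zero, map_inv₀, map_pow,
          Complex.conj_conj]
      · simp only [Sum.elim_inl, Fin.mk_one, Fin.isValue, Matrix.cons_val_one, Matrix.cons_val_zero,
          map_div₀, map_pow, Complex.conj_conj, hΦ₁']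
      · simp only [Sum.elim_inr, Fin.zero_eta, Fin.isValue, Matrix.cons_val_zero,
          ← Complex.exp_conj, hℓ₀']
      · simp only [Sum.elim_inr, Fin.mk_one, Fin.isValue, Matrix.cons_val_one, Matrix.cons_val_zero,
          ← Complex.exp_conj, hℓ₁']
    refine ⟨A', g', ℓu', ℓv', Φ₁', ℓ₀', ℓ₁', T', ?_, ?_, analyticAt_conj_conj hℓu,
      analyticAt_conj_conj hℓv, fun s hs0 hsρ => ?_, fun δ hδ => ?_, analyticAt_conj_conj hT, ?_,
      analyticAt_conj_conj hℓ₀, analyticAt_conj_conj hℓ₁, analyticAt_conj_conj hΦ₁,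
      fun t ht0 htr => ?_, fun s hs0 hsρ => ?_⟩
    · exact (analyticAt_conj_conj hg).neg
    · simp [hg', hg0]
    · rw [← hconj s]
      exact conj_apply_mem_of_isDefinedOver_bot hW
        (hin (conj s) (by simpa using hs0) (by simpa using hsρ))
    · have hinj : Set.InjOn (fun x : Fin 2 → ℂ => fun j => conj (x j)) Set.univ := by
        intro x _ y _ hxy
        funext j
        have := congrFun hxy j
        exact (starRingEnd ℂ).injective (by simpa using this)
      refine ((hhit δ hδ).image (hinj.mono (Set.subset_univ _))).mono ?_
      rintro _ ⟨x, ⟨hxH, ρ, hρ, hρδ, hpt⟩, rfl⟩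
      refine ⟨conj_comp_mem_indepExpPoints hW hxH, ρ, hρ, hρδ, ?_⟩
      rw [← conj_sumElim_exp, hpt, ← hconj (ρ : ℂ), Complex.conj_ofReal]
    · simp [hT', hT0]
    · rw [← hconjb t]
      exact conj_apply_mem_of_isDefinedOver_bot hW
        (hbr (conj t) (by simpa using ht0) (by simpa using htr))
    · obtain ⟨h0, hr, h1, h2, h3, h4⟩ := hlink (conj s) (by simpa using hs0) (by simpa using hsρ)
      refine ⟨by simpa [hT'] using h0, by simpa [hT'] using hr, ?_, ?_, ?_, ?_⟩
      · show ((conj (T (conj s))) ^ e)⁻¹ = 2 * (Real.pi : ℂ) * I * s⁻¹ ^ e + conj (ℓu (conj s))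
        rw [← map_pow, ← map_inv₀, h1]
        simp only [map_add, map_mul, map_neg, map_one, map_pow, map_inv₀, Complex.conj_conj,
          map_ofNat, Complex.conj_ofReal, Complex.conj_I]
        ring
      · show conj (Φ₁ (conj (conj (T (conj s))))) / (conj (T (conj s))) ^ N =
          2 * (Real.pi : ℂ) * I * (Polynomial.eval s⁻¹ A' + -conj (g (conj s))) + conj (ℓv (conj s))
        rw [Complex.conj_conj, ← map_pow, ← map_div₀, h2]
        simp only [map_add, map_mul, conj_eval, map_inv₀, Complex.conj_conj, map_ofNat,
          Complex.conj_ofReal, Complex.conj_I, hA', Polynomial.eval_neg]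
        ring
      · show conj (ℓ₀ (conj (conj (T (conj s))))) = conj (ℓu (conj s))
        rw [Complex.conj_conj, h3]
      · show conj (ℓ₁ (conj (conj (T (conj s))))) = conj (ℓv (conj s))
        rw [Complex.conj_conj, h4]

/-! ### The trichotomy -/

/-- **The cusp trichotomy, with the algebraic uniformisation of the cusp** (see the module
docstring): `cusp_trichotomy` whose first case records in addition `N₀`, `T, ℓ₀, ℓ₁, Φ₁` and
`r > 0` with the `t`-branch `((t⁻ᵉ, Φ₁ t / t^{N₀}), (e^{ℓ₀ t}, e^{ℓ₁ t})) ⊆ W` (`0 < |t| < r`) and the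
identification of the cusp point at `σ` with the `t`-branch point at `t = T σ`. [folklore] -/
theorem cusp_trichotomy_alg {W : Set (Fin 2 ⊕ Fin 2 → ℂ)} (hW : IsDefinedOver (⊥ : Subfield ℂ) W)
    (hdim : zariskiDim ℂ W < 2) {e : ℕ} (he : 0 < e) {N : ℕ} {r : ℝ} (hr : 0 < r)
    {Φ₁ Φ₂ Φ₃ : ℂ → ℂ}
    (hana : ∀ t : ℂ, ‖t‖ < r → AnalyticAt ℂ Φ₁ t ∧ AnalyticAt ℂ Φ₂ t ∧ AnalyticAt ℂ Φ₃ t)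
    (hWb : ∀ t : ℂ, 0 < ‖t‖ → ‖t‖ < r → 𝔟[e, N, Φ₁, Φ₂, Φ₃, t] ∈ W)
    (hhit : ∀ δ : ℝ, 0 < δ → Set.Infinite {x | x ∈ indepExpPoints W ∧ ∃ t : ℂ, 0 < ‖t‖ ∧
      ‖t‖ < δ ∧ Sum.elim x (Complex.exp ∘ x) = 𝔟[e, N, Φ₁, Φ₂, Φ₃, t]}) :
    (∃ (s : Fin 2 ≃ Fin 2) (e : ℕ) (A : Polynomial ℂ) (g ℓu ℓv : ℂ → ℂ) (ρ : ℝ)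
        (N₀ : ℕ) (T ℓ₀ ℓ₁ Φ₁ : ℂ → ℂ) (r : ℝ),
        let w : ℕ → ℂ := fun N => (((N : ℝ) ^ ((e : ℝ)⁻¹) : ℝ) : ℂ);
        let x : ℕ → Fin 2 → ℂ := fun N =>
          (![2 * ↑π * I * (N : ℂ) + ℓu (w N)⁻¹,
              2 * ↑π * I * (A.eval (w N) + g (w N)⁻¹) + ℓv (w N)⁻¹] : Fin 2 → ℂ) ∘ s;
        let y : ℕ → Fin 2 → ℂ := fun N =>
          (![Complex.exp (ℓu (w N)⁻¹), Complex.exp (ℓv (w N)⁻¹)] : Fin 2 → ℂ) ∘ s;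
        (0 < e ∧ 0 < ρ ∧ AnalyticAt ℂ g 0 ∧ g 0 = 0 ∧ AnalyticAt ℂ ℓu 0 ∧ AnalyticAt ℂ ℓv 0 ∧
        (¬ ∃ P : MvPolynomial (Fin 2) ℂ, P ≠ 0 ∧
            ∀ᶠ z in 𝓝 (0 : ℂ), MvPolynomial.eval ![z, g z] P = 0) ∧
        (∀ σ : ℂ, 0 < ‖σ‖ → ‖σ‖ < ρ →
          Sum.elim ((![2 * ↑π * I * σ⁻¹ ^ e + ℓu σ,
                        2 * ↑π * I * (A.eval σ⁻¹ + g σ) + ℓv σ] : Fin 2 → ℂ) ∘ s)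
            ((![Complex.exp (ℓu σ), Complex.exp (ℓv σ)] : Fin 2 → ℂ) ∘ s) ∈ W) ∧
        Set.Infinite {N : ℕ | x N ∈ indepExpPoints W ∧ Complex.exp ∘ x N = y N ∧
          ∃ L : ℤ, A.eval (w N) + g (w N)⁻¹ = L}) ∧
        (0 < r ∧ AnalyticAt ℂ T 0 ∧ T 0 = 0 ∧ AnalyticAt ℂ ℓ₀ 0 ∧ AnalyticAt ℂ ℓ₁ 0 ∧
          AnalyticAt ℂ Φ₁ 0 ∧
        (∀ t : ℂ, 0 < ‖t‖ → ‖t‖ < r →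
          Sum.elim ((![(t ^ e)⁻¹, Φ₁ t / t ^ N₀] : Fin 2 → ℂ) ∘ s)
            ((![Complex.exp (ℓ₀ t), Complex.exp (ℓ₁ t)] : Fin 2 → ℂ) ∘ s) ∈ W) ∧
        (∀ σ : ℂ, 0 < ‖σ‖ → ‖σ‖ < ρ → 0 < ‖T σ‖ ∧ ‖T σ‖ < r ∧
          ((T σ) ^ e)⁻¹ = 2 * ↑π * I * σ⁻¹ ^ e + ℓu σ ∧
          Φ₁ (T σ) / (T σ) ^ N₀ = 2 * ↑π * I * (A.eval σ⁻¹ + g σ) + ℓv σ ∧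
          ℓ₀ (T σ) = ℓu σ ∧ ℓ₁ (T σ) = ℓv σ))) ∨
      (∃ a b : ℤ, (a ≠ 0 ∨ b ≠ 0) ∧ ∃ c : ℂ,
        Set.Infinite {x : Fin 2 → ℂ | x ∈ indepExpPoints W ∧ (a : ℂ) * x 0 + (b : ℂ) * x 1 = c}) ∨
      (∃ ω : Fin 2 → ℂ,
        Set.Infinite {x : Fin 2 → ℂ | x ∈ indepExpPoints W ∧ Complex.exp ∘ x = ω}) := by
  classical
  obtain ⟨hΦ₁, hΦ₂, hΦ₃⟩ := hana 0 (by simpa using hr)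
  have hWev : ∀ᶠ t in 𝓝[≠] (0 : ℂ), 𝔟[e, N, Φ₁, Φ₂, Φ₃, t] ∈ W := by
    have hball : ∀ᶠ t in 𝓝[≠] (0 : ℂ), ‖t‖ < r :=
      eventually_nhdsWithin_of_eventually_nhds
        (eventually_norm_sub_lt 0 hr |>.mono fun t ht => by simpa using ht)
    filter_upwards [hball, self_mem_nhdsWithin] with t ht ht0
    have htne : t ≠ 0 := by rintro rfl; exact ht0 (Set.mem_singleton 0)
    exact hWb t (norm_pos_iff.2 htne) ht
  -- ### orders and logarithms of the multiplicative coordinates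
  have hne : ∀ (j : Fin 2) (Φ : ℂ → ℂ), (∀ (x : Fin 2 → ℂ) (t : ℂ),
      Sum.elim x (Complex.exp ∘ x) = 𝔟[e, N, Φ₁, Φ₂, Φ₃, t] → exp (x j) = Φ t / t ^ N) →
      ∃ᶠ t in 𝓝[≠] (0 : ℂ), Φ t ≠ 0 := by
    intro j Φ hΦ
    refine frequently_nhdsNE_of_forall_exists fun δ hδ => ?_
    obtain ⟨x, hxH, t, ht0, htδ, hpt⟩ := (hhit δ hδ).nonempty
    refine ⟨t, ht0, htδ, fun h0 => ?_⟩
    have := hΦ x t hpt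
    rw [h0, zero_div] at this
    exact Complex.exp_ne_zero _ this
  have hne₂ : ∃ᶠ t in 𝓝[≠] (0 : ℂ), Φ₂ t ≠ 0 := hne 0 Φ₂ fun x t hpt => by
    have := congrFun hpt (Sum.inr 0); simpa using this
  have hne₃ : ∃ᶠ t in 𝓝[≠] (0 : ℂ), Φ₃ t ≠ 0 := hne 1 Φ₃ fun x t hpt => by
    have := congrFun hpt (Sum.inr 1); simpa using this
  obtain ⟨μ₀, -, -, ℓ₀, -, -, hℓ₀, -, -, -, hy₀⟩ := exists_zpow_exp_form hΦ₂ hne₂ N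
  obtain ⟨μ₁, -, -, ℓ₁, -, -, hℓ₁, -, -, -, hy₁⟩ := exists_zpow_exp_form hΦ₃ hne₃ N
  -- ### the log-type ends
  by_cases hμ : μ₀ ≠ 0 ∨ μ₁ ≠ 0
  · by_cases hreg : ∃ Φh : ℂ → ℂ, AnalyticAt ℂ Φh 0 ∧ ∀ᶠ t in 𝓝[≠] (0 : ℂ),
        (μ₁ : ℂ) * ((t ^ e)⁻¹ - ℓ₀ t) - (μ₀ : ℂ) * (Φ₁ t / t ^ N - ℓ₁ t) = Φh t
    · obtain ⟨Φh, hΦh, hregev⟩ := hreg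
      exact Or.inr (Or.inl (exists_degenerate_section_of_logType_regular hdim he hΦ₁ hΦ₂ hΦ₃ hWev
        hhit hℓ₀ hℓ₁ hy₀ hy₁ hμ hΦh hregev))
    · exact (false_of_logType_pole hΦ₁ hhit hℓ₀ hℓ₁ hy₀ hy₁ hμ hreg).elim
  -- ### the log-free ends
  · push Not at hμ
    obtain ⟨hμ₀, hμ₁⟩ := hμ
    subst hμ₀ hμ₁
    simp only [zpow_zero, one_mul] at hy₀ hy₁
    obtain ⟨ε, A, g, ℓu, ℓv, ρ₀, T, r₁, hε, hρ₀, hg, hg0, hℓu, hℓv, hin, hreal, hr₁, hT, hT0, hbr,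
      hlink⟩ := exists_cusp_form_of_logFree_alg he hΦ₁ hWev hhit hℓ₀ hℓ₁ hy₀ hy₁
    obtain ⟨A', g', ℓu', ℓv', Φ₁', ℓ₀', ℓ₁', T', hg', hg'0, hℓu', hℓv', hin', hreal', hT', hT'0,
      hℓ₀', hℓ₁', hΦ₁', hbr', hlink'⟩ :=
      exists_normalised_cusp_alg hW hε hg hg0 hℓu hℓv hin hreal hT hT0 hℓ₀ hℓ₁ hΦ₁ hbr hlink
    by_cases htail : ∃ P : MvPolynomial (Fin 2) ℂ, P ≠ 0 ∧
        ∀ᶠ z in 𝓝 (0 : ℂ), MvPolynomial.eval ![z, g' z] P = 0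
    · exact Or.inr (classical_class_of_algebraic_tail hdim he hρ₀ hg' hℓu' hℓv' hin' hreal' htail)
    · refine Or.inl ⟨Equiv.refl _, e, A', g', ℓu', ℓv', ρ₀, N, T', ℓ₀', ℓ₁', Φ₁', r₁, ?_⟩
      intro w x y
      refine ⟨⟨he, hρ₀, hg', hg'0, hℓu', hℓv', htail, fun σ hσ0 hσρ => ?_, ?_⟩, hr₁, hT', hT'0,
        hℓ₀', hℓ₁', hΦ₁', fun t ht0 htr => ?_, hlink'⟩
      · simpa only [Equiv.coe_refl, Function.comp_id] using hin' σ hσ0 hσρ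
      · have := infinite_nat_hits (W := W) he hreal'
        simpa only [x, y, w, Equiv.coe_refl, Function.comp_id] using this
      · simpa only [Equiv.coe_refl, Function.comp_id] using hbr' t ht0 htr

end Literature.NumberTheory.Transcendental

end
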